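import Mathlib.Tactic.Ring
import Mathlib.Tactic.Linarith
import Literature.Computability.MetaComplexity.CuttingPlanes
import HarnessLib

/-!
# Splitting a cutting planes refutation along a shared assignment (Pudlák 1997, Thm. 3)

The semantic half of the feasible interpolation theorem for cutting planes with small
coefficients (Pudlák 1997, Thm. 3; Bonet–Pitassi–Raz 1997, §4; Krajíček 1997, §6).
Variables are three-sorted, `X ⊕ (Y ⊕ Z)`: SHARED `x`, private `y` of `A(x, y)` and private
`z` of `B(x, z)`; the clauses of `A` mention only `x`- and `y`-literals (`CPSplit.okA`), those of
`B` only NEGATIVE `x`-literals and `z`-literals (`CPSplit.okB`).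

Fix `a : X → Bool`.  Walking along a `CP` derivation `π` from `A ++ B` we attach to every line
`∑ αx + ∑ βy + ∑ γz ≥ d` an integer `dz` ("how much of `d` the `z`-part owes") and a flag `uz`
("`B(a,·)` is already refuted"), `CPSplit.dz` / `CPSplit.uz`, by the recursion
`CPSplit.lineVal`: clauses of `A` and bounds on `x`, `y` give `0`; a clause of `B` gives
`d - ∑ α a(x)`; bounds on `z` give their constant; addition adds, multiplication multiplies,
division rounds up (`CPLine.ceilDiv`); and every value is CLAMPED into the window
`[-Wz, Wz]`, `Wz = ∑ |γ|` (`CPSplit.zNormHom`), raising the flag when the raw value exceeds `Wz`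
(then `∑ γz ≥ dz` is unsatisfiable).  The invariants (`CPSplit.dz_invariant`): unless the flag
is raised, `B(a,·) ⊨ ∑ γ z ≥ dz` and `A(a,·) ⊨ ∑ β y ≥ d - ∑ α a(x) - dz`; a raised flag refutes
`B(a,·)`.  At a contradiction `0 ≥ d > 0` the bit `uz ∨ (dz ≥ 1)` therefore decides which of
`A(a,·)`, `B(a,·)` is unsatisfiable (`CPSplit.interp_correct`).  The clamping keeps all numbers
in `[-W, W]`, `W = cpNorm π`, which is what makes the recursion computable by MONOTONE Boolean
circuits of size polynomial in `|π|` and `W` (unary arithmetic; `CuttingPlanesInterpolation.lean`).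

## References

* P. Pudlák, J. Symbolic Logic 62 (1997), Thm. 3 [Pudlak1997].
* M. Bonet, T. Pitassi, R. Raz, J. Symbolic Logic 62 (1997), §4 [BonetPitassiRaz1997].
* J. Krajíček, J. Symbolic Logic 62 (1997), §6 [Krajicek1997].
-/

namespace Literature.Computability.MetaComplexity

open Finset Literature.Computability.Complexity CPLine

namespace CPSplit

variable {X Y Z : Type*}

/-! ### Sorts of literals and partial evaluations -/

/-- Literals allowed in `A`: `x`-literals (any sign) and `y`-literals. [cite: Pudlak1997, Thm. 3] -/
def okA : Literal (X ⊕ (Y ⊕ Z)) → Bool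
  | (Sum.inl _, _) => true
  | (Sum.inr (Sum.inl _), _) => true
  | (Sum.inr (Sum.inr _), _) => false

/-- Literals allowed in `B`: NEGATIVE `x`-literals and `z`-literals (the monotone case).
[cite: Pudlak1997, Thm. 3] -/
def okB : Literal (X ⊕ (Y ⊕ Z)) → Bool
  | (Sum.inl _, b) => !b
  | (Sum.inr (Sum.inl _), _) => false
  | (Sum.inr (Sum.inr _), _) => true

/-- The `0/1` value of a shared variable under `a`. [folklore] -/
def bX (a : X → Bool) (x : X) : ℤ := if a x then 1 else 0

/-- `bX` is `0` or `1`. [folklore] -/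
theorem bX_nonneg (a : X → Bool) (x : X) : 0 ≤ bX a x := by unfold bX; split_ifs <;> norm_num

/-- `bX` is `0` or `1`. [folklore] -/
theorem bX_le_one (a : X → Bool) (x : X) : bX a x ≤ 1 := by unfold bX; split_ifs <;> norm_num

/-- The `x`-part `∑_x α_x a(x)` of a coefficient vector, under the shared assignment `a`.
[cite: Pudlak1997, Thm. 3 (proof)] -/
noncomputable def xHom (a : X → Bool) : ((X ⊕ (Y ⊕ Z)) →₀ ℤ) →+ ℤ :=
  Finsupp.liftAddHom fun v => Sum.elim (fun x => AddMonoidHom.mulRight (bX a x))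
    (Sum.elim (fun _ => (0 : ℤ →+ ℤ)) (fun _ => (0 : ℤ →+ ℤ))) v

/-- The `y`-part `∑_y β_y σ(y)` of a coefficient vector. [cite: Pudlak1997, Thm. 3 (proof)] -/
noncomputable def yHom (σ : X ⊕ (Y ⊕ Z) → Bool) : ((X ⊕ (Y ⊕ Z)) →₀ ℤ) →+ ℤ :=
  Finsupp.liftAddHom fun v => Sum.elim (fun _ => (0 : ℤ →+ ℤ))
    (Sum.elim (fun y => AddMonoidHom.mulRight (bit σ (Sum.inr (Sum.inl y)))) (fun _ => (0 : ℤ →+ ℤ))) v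

/-- The `z`-part `∑_z γ_z σ(z)` of a coefficient vector. [cite: Pudlak1997, Thm. 3 (proof)] -/
noncomputable def zHom (σ : X ⊕ (Y ⊕ Z) → Bool) : ((X ⊕ (Y ⊕ Z)) →₀ ℤ) →+ ℤ :=
  Finsupp.liftAddHom fun v => Sum.elim (fun _ => (0 : ℤ →+ ℤ))
    (Sum.elim (fun _ => (0 : ℤ →+ ℤ)) (fun z => AddMonoidHom.mulRight (bit σ (Sum.inr (Sum.inr z))))) v

/-- The `z`-NORM `∑_z |γ_z|` of a coefficient vector: the clamping window. [cite: Pudlak1997, Thm. 3 (proof)] -/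
noncomputable def zNormHom : ((X ⊕ (Y ⊕ Z)) →₀ ℤ) → ℤ := fun f =>
  f.sum fun v c => Sum.elim (fun _ => (0 : ℤ)) (Sum.elim (fun _ => (0 : ℤ)) (fun _ => |c|)) v

section Homs

variable (a : X → Bool) (σ : X ⊕ (Y ⊕ Z) → Bool)

/-- `xHom` on singles. [folklore] -/
@[simp] theorem xHom_single_inl (x : X) (c : ℤ) : xHom (Y := Y) (Z := Z) a (Finsupp.single (Sum.inl x) c) = c * bX a x := by
  simp [xHom]

/-- `xHom` vanishes on `y`. [folklore] -/
@[simp] theorem xHom_single_inr_inl (y : Y) (c : ℤ) : xHom (Z := Z) a (Finsupp.single (Sum.inr (Sum.inl y)) c) = 0 := by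
  simp [xHom]

/-- `xHom` vanishes on `z`. [folklore] -/
@[simp] theorem xHom_single_inr_inr (z : Z) (c : ℤ) : xHom (Y := Y) a (Finsupp.single (Sum.inr (Sum.inr z)) c) = 0 := by
  simp [xHom]

/-- `yHom` vanishes on `x`. [folklore] -/
@[simp] theorem yHom_single_inl (x : X) (c : ℤ) : yHom σ (Finsupp.single (Sum.inl x) c) = 0 := by
  simp [yHom]

/-- `yHom` on `y`. [folklore] -/
@[simp] theorem yHom_single_inr_inl (y : Y) (c : ℤ) :
    yHom σ (Finsupp.single (Sum.inr (Sum.inl y)) c) = c * bit σ (Sum.inr (Sum.inl y)) := by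
  simp [yHom]

/-- `yHom` vanishes on `z`. [folklore] -/
@[simp] theorem yHom_single_inr_inr (z : Z) (c : ℤ) : yHom σ (Finsupp.single (Sum.inr (Sum.inr z) : X ⊕ (Y ⊕ Z)) c) = 0 := by
  simp [yHom]

/-- `zHom` vanishes on `x`. [folklore] -/
@[simp] theorem zHom_single_inl (x : X) (c : ℤ) : zHom σ (Finsupp.single (Sum.inl x) c) = 0 := by
  simp [zHom]

/-- `zHom` vanishes on `y`. [folklore] -/
@[simp] theorem zHom_single_inr_inl (y : Y) (c : ℤ) : zHom σ (Finsupp.single (Sum.inr (Sum.inl y) : X ⊕ (Y ⊕ Z)) c) = 0 := by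
  simp [zHom]

/-- `zHom` on `z`. [folklore] -/
@[simp] theorem zHom_single_inr_inr (z : Z) (c : ℤ) :
    zHom σ (Finsupp.single (Sum.inr (Sum.inr z) : X ⊕ (Y ⊕ Z)) c) = c * bit σ (Sum.inr (Sum.inr z)) := by
  simp [zHom]

/-- **The three-way split of a line's left-hand side** under an assignment extending `a`:
`∑ = x`-part `+ y`-part `+ z`-part. [cite: Pudlak1997, Thm. 3 (proof)] -/
theorem evalHom_eq_xHom_add (hσ : ∀ x, σ (Sum.inl x) = a x) (f : (X ⊕ (Y ⊕ Z)) →₀ ℤ) :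
    evalHom σ f = xHom a f + yHom σ f + zHom σ f := by
  suffices h : evalHom σ = xHom a + yHom σ + zHom σ by rw [h]; rfl
  refine Finsupp.addHom_ext fun v c => ?_
  rcases v with x | y | z
  · simp [bit, bX, hσ x]
  · simp
  · simp

/-- `zNormHom` is nonnegative. [folklore] -/
theorem zNormHom_nonneg (f : (X ⊕ (Y ⊕ Z)) →₀ ℤ) : 0 ≤ zNormHom f := by
  unfold zNormHom Finsupp.sum
  refine Finset.sum_nonneg fun v _ => ?_
  rcases v with x | y | z <;> simp

/-- `|z`-part`| ≤ z`-norm. [folklore] -/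
theorem abs_zHom_le (f : (X ⊕ (Y ⊕ Z)) →₀ ℤ) : |zHom σ f| ≤ zNormHom f := by
  have h : zHom σ f = f.sum fun v c => Sum.elim (fun _ => (0 : ℤ))
      (Sum.elim (fun _ => (0 : ℤ)) (fun z => c * bit σ (Sum.inr (Sum.inr z)))) v := by
    simp only [zHom, Finsupp.liftAddHom_apply]
    refine Finsupp.sum_congr fun v _ => ?_
    rcases v with x | y | z <;> simp
  rw [h]
  unfold zNormHom Finsupp.sum
  refine (Finset.abs_sum_le_sum_abs _ _).trans (Finset.sum_le_sum fun v _ => ?_)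
  rcases v with x | y | z
  · simp
  · simp
  · simp only [Sum.elim_inr, abs_mul]
    calc |f (Sum.inr (Sum.inr z))| * |bit σ (Sum.inr (Sum.inr z))| ≤ |f (Sum.inr (Sum.inr z))| * 1 :=
          mul_le_mul_of_nonneg_left
            (by rw [abs_le]; exact ⟨by linarith [bit_nonneg σ (Sum.inr (Sum.inr z))], bit_le_one σ _⟩)
            (abs_nonneg _)
      _ = |f (Sum.inr (Sum.inr z))| := mul_one _

/-- The `z`-norm is bounded by the `ℓ¹`-norm of the line. [folklore] -/
theorem zNormHom_le_norm (L : CPLine (X ⊕ (Y ⊕ Z))) : zNormHom L.coeff ≤ L.norm := by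
  refine le_trans ?_ (Int.ofNat_le.2 L.sum_natAbs_le_norm)
  rw [← sum_abs_eq]
  unfold zNormHom Finsupp.sum
  refine Finset.sum_le_sum fun v _ => ?_
  rcases v with x | y | z <;> simp

/-- The `x`-part is bounded by the `ℓ¹`-norm of the line. [folklore] -/
theorem abs_xHom_le_norm (L : CPLine (X ⊕ (Y ⊕ Z))) : |xHom a L.coeff| ≤ L.norm := by
  have h : xHom (Y := Y) (Z := Z) a L.coeff = L.coeff.sum fun v c => Sum.elim (fun x => c * bX a x)
      (Sum.elim (fun _ => (0 : ℤ)) (fun _ => (0 : ℤ))) v := by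
    simp only [xHom, Finsupp.liftAddHom_apply]
    refine Finsupp.sum_congr fun v _ => ?_
    rcases v with x | y | z <;> simp
  rw [h]
  refine le_trans ?_ (Int.ofNat_le.2 L.sum_natAbs_le_norm)
  rw [← sum_abs_eq]
  unfold Finsupp.sum
  refine (Finset.abs_sum_le_sum_abs _ _).trans (Finset.sum_le_sum fun v _ => ?_)
  rcases v with x | y | z
  · simp only [Sum.elim_inl, abs_mul]
    calc |L.coeff (Sum.inl x)| * |bX a x| ≤ |L.coeff (Sum.inl x)| * 1 :=
          mul_le_mul_of_nonneg_left (by rw [abs_le]; exact ⟨by linarith [bX_nonneg a x], bX_le_one a x⟩)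
            (abs_nonneg _)
      _ = |L.coeff (Sum.inl x)| := mul_one _
  · simp
  · simp

end Homs

/-! ### Clause lines -/

section Clauses

variable [DecidableEq X] [DecidableEq Y] [DecidableEq Z]

/-- A clause of `A` has no `z`-part. [cite: Pudlak1997, Thm. 3 (proof)] -/
theorem zHom_ofClause_eq_zero {C : Clause (X ⊕ (Y ⊕ Z))} (hC : ∀ l ∈ C, okA l = true)
    (σ : X ⊕ (Y ⊕ Z) → Bool) : zHom σ (ofClause C).coeff = 0 := by
  unfold ofClause
  simp only [map_sum]
  refine Finset.sum_eq_zero fun l hl => ?_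
  have h := hC l (List.mem_toFinset.1 hl)
  obtain ⟨v, b⟩ := l
  rcases v with x | y | z
  · simp [litCoeff]
  · simp [litCoeff]
  · simp [okA] at h

/-- A clause of `B` has no `y`-part. [cite: Pudlak1997, Thm. 3 (proof)] -/
theorem yHom_ofClause_eq_zero {C : Clause (X ⊕ (Y ⊕ Z))} (hC : ∀ l ∈ C, okB l = true)
    (σ : X ⊕ (Y ⊕ Z) → Bool) : yHom σ (ofClause C).coeff = 0 := by
  unfold ofClause
  simp only [map_sum]
  refine Finset.sum_eq_zero fun l hl => ?_
  have h := hC l (List.mem_toFinset.1 hl)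
  obtain ⟨v, b⟩ := l
  rcases v with x | y | z
  · simp [litCoeff]
  · simp [okB] at h
  · simp [litCoeff]

end Clauses

/-! ### The recursion -/

/-- Clamping into `[lo, hi]`. [folklore] -/
def clamp (r lo hi : ℤ) : ℤ := max lo (min r hi)

/-- `clamp` stays in the window. [folklore] -/
theorem lo_le_clamp (r lo hi : ℤ) : lo ≤ clamp r lo hi := le_max_left _ _

/-- `clamp` stays in the window (`lo ≤ hi`). [folklore] -/
theorem clamp_le_hi {r lo hi : ℤ} (h : lo ≤ hi) : clamp r lo hi ≤ hi :=
  max_le h (min_le_right _ _)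

/-- Below the upper edge, `clamp` only raises. [folklore] -/
theorem le_clamp_of_le {r lo hi : ℤ} (h : r ≤ hi) : r ≤ clamp r lo hi := by
  unfold clamp; rw [min_eq_left h]; exact le_max_right _ _

/-- Below the upper edge and above the lower edge, `clamp` is the identity. [folklore] -/
theorem clamp_eq_self {r lo hi : ℤ} (h₁ : lo ≤ r) (h₂ : r ≤ hi) : clamp r lo hi = r := by
  unfold clamp; rw [min_eq_left h₂, max_eq_right h₁]

section Recursion

variable (A : CNF (X ⊕ (Y ⊕ Z))) (π : List (CPStep (X ⊕ (Y ⊕ Z))))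

/-- The `z`-window of line `k`: `Wz = ∑ |γ|` (junk `0` beyond the derivation). [cite: Pudlak1997, Thm. 3 (proof)] -/
noncomputable def Wz (k : ℕ) : ℤ :=
  match π[k]? with
  | none => 0
  | some s => zNormHom s.line.coeff

/-- The window is nonnegative. [folklore] -/
theorem Wz_nonneg (k : ℕ) : 0 ≤ Wz π k := by
  unfold Wz
  rcases π[k]? with _ | s
  · exact le_rfl
  · exact zNormHom_nonneg _

/-- The window is bounded by the norm of the derivation. [folklore] -/
theorem Wz_le_cpNorm (k : ℕ) : Wz π k ≤ cpNorm π := by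
  unfold Wz
  rcases hk : π[k]? with _ | s <;> dsimp only
  · exact_mod_cast Nat.zero_le _
  · exact (zNormHom_le_norm s.line).trans (by exact_mod_cast norm_le_cpNorm (List.mem_of_getElem? hk))

variable [DecidableEq X] [DecidableEq Y] [DecidableEq Z] (a : X → Bool)

open Classical in
/-- The RAW value and flag of line `k` computed from the (value, flag) pairs `prev i` of the
earlier lines: `0` for clauses of `A` and bounds on `x`, `y`; `d - ∑ α a(x)` for the other
clauses; the constant for bounds on `z`; sum / multiple / rounded-up quotient for the rules,
with the flags OR-ed. Invalid references (impossible in a derivation) give `(0, false)`.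
[cite: Pudlak1997, Thm. 3 (proof)] -/
noncomputable def rawVal (k : ℕ) (prev : ℕ → ℤ × Bool) : ℤ × Bool :=
  match π[k]? with
  | none => (0, false)
  | some s =>
    match s.rule with
    | .initial =>
      if ∃ C ∈ A, s.line = ofClause C then (0, false) else (s.line.const - xHom a s.line.coeff, false)
    | .lower v => (Sum.elim (fun _ => 0) (Sum.elim (fun _ => 0) (fun _ => s.line.const)) v, false)
    | .upper v => (Sum.elim (fun _ => 0) (Sum.elim (fun _ => 0) (fun _ => s.line.const)) v, false)
    | .add i j => ((prev i).1 + (prev j).1, (prev i).2 || (prev j).2)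
    | .mul c i => ((c : ℤ) * (prev i).1, (prev i).2)
    | .div c i => (ceilDiv (prev i).1 c, (prev i).2)

/-- The CLAMPED value and flag of line `k` from the earlier pairs: clamp the raw value into
`[-Wz, Wz]`, and raise the flag if the raw value exceeds `Wz`. [cite: Pudlak1997, Thm. 3 (proof)] -/
noncomputable def lineVal (k : ℕ) (prev : ℕ → ℤ × Bool) : ℤ × Bool :=
  (clamp (rawVal A π a k prev).1 (-Wz π k) (Wz π k),
    (rawVal A π a k prev).2 || decide (Wz π k < (rawVal A π a k prev).1))

/-- The (value, flag) pairs of the lines `0, …, k-1`, in order. [folklore] -/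
noncomputable def vlist : ℕ → List (ℤ × Bool)
  | 0 => []
  | k + 1 => vlist k ++ [lineVal A π a k fun i => (vlist k).getD i (0, false)]

/-- The (value, flag) pair `(dz, uz)` of line `k` under the shared assignment `a`.
[cite: Pudlak1997, Thm. 3 (proof)] -/
noncomputable def dzuz (k : ℕ) : ℤ × Bool :=
  lineVal A π a k fun i => (vlist A π a k).getD i (0, false)

/-- The value `dz` of line `k`. [cite: Pudlak1997, Thm. 3 (proof)] -/
noncomputable def dz (k : ℕ) : ℤ := (dzuz A π a k).1

/-- The flag `uz` of line `k`. [cite: Pudlak1997, Thm. 3 (proof)] -/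
noncomputable def uz (k : ℕ) : Bool := (dzuz A π a k).2

/-- `vlist` lists `k` pairs. [folklore] -/
@[simp] theorem length_vlist : ∀ k, (vlist A π a k).length = k
  | 0 => rfl
  | k + 1 => by rw [vlist, List.length_append, length_vlist k]; rfl

/-- The listed pairs are the pairs. [folklore] -/
theorem getD_vlist : ∀ {k i : ℕ}, i < k → (vlist A π a k).getD i (0, false) = dzuz A π a i
  | 0, _, h => absurd h (Nat.not_lt_zero _)
  | k + 1, i, h => by
    rw [vlist, List.getD_eq_getElem?_getD]
    rcases Nat.lt_succ_iff_lt_or_eq.1 h with h' | rfl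
    · rw [List.getElem?_append_left (by simpa using h'), ← List.getD_eq_getElem?_getD]
      exact getD_vlist h'
    · rw [List.getElem?_append_right (by simp), length_vlist, Nat.sub_self]
      rfl

/-- The earlier pairs, as a function (junk beyond `k`). [folklore] -/
noncomputable def prevOf (k : ℕ) : ℕ → ℤ × Bool := fun i => if i < k then dzuz A π a i else (0, false)

/-- **The recursion**: the pair of line `k` is `lineVal` of the earlier pairs. [folklore] -/
theorem dzuz_eq (k : ℕ) : dzuz A π a k = lineVal A π a k (prevOf A π a k) := by
  unfold dzuz prevOf
  congr 1
  funext i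
  split_ifs with h
  · exact getD_vlist A π a h
  · rw [List.getD_eq_getElem?_getD, List.getElem?_eq_none (by simpa using not_lt.1 h)]
    rfl

/-- `dz` is in the window: `-Wz ≤ dz`. [folklore] -/
theorem neg_Wz_le_dz (k : ℕ) : -Wz π k ≤ dz A π a k := by
  unfold dz; rw [dzuz_eq]; exact lo_le_clamp _ _ _

/-- `dz` is in the window: `dz ≤ Wz`. [folklore] -/
theorem dz_le_Wz (k : ℕ) : dz A π a k ≤ Wz π k := by
  unfold dz; rw [dzuz_eq]
  exact clamp_le_hi (by linarith [Wz_nonneg π k])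

/-- **All values stay in `[-W, W]`**, `W = cpNorm π`. [cite: Pudlak1997, Thm. 3 (proof)] -/
theorem abs_dz_le_cpNorm (k : ℕ) : |dz A π a k| ≤ cpNorm π := by
  rw [abs_le]
  exact ⟨by linarith [neg_Wz_le_dz A π a k, Wz_le_cpNorm π k],
    (dz_le_Wz A π a k).trans (Wz_le_cpNorm π k)⟩

end Recursion

/-! ### The invariants -/

section Invariant

variable {A B : CNF (X ⊕ (Y ⊕ Z))} {π : List (CPStep (X ⊕ (Y ⊕ Z)))} (a : X → Bool)

/-- `F(a, ·)` is satisfiable: some assignment extending `a` satisfies `F`.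
[cite: Pudlak1997, Thm. 3] -/
def SatOver (F : CNF (X ⊕ (Y ⊕ Z))) (a : X → Bool) : Prop :=
  ∃ σ : X ⊕ (Y ⊕ Z) → Bool, (∀ x, σ (Sum.inl x) = a x) ∧ F.eval σ = true

/-- The three invariants of a (value, flag) pair `(r, u)` attached to the line `L`:
a raised flag refutes `B(a,·)`; otherwise `B(a,·) ⊨ ∑ γ z ≥ r` and
`A(a,·) ⊨ ∑ β y ≥ d - ∑ α a(x) - r`. [cite: Pudlak1997, Thm. 3 (proof)] -/
def Inv (A B : CNF (X ⊕ (Y ⊕ Z))) (a : X → Bool) (L : CPLine (X ⊕ (Y ⊕ Z))) (r : ℤ) (u : Bool) : Prop :=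
  (u = true → ¬ SatOver B a) ∧
  (u = false → ∀ σ : X ⊕ (Y ⊕ Z) → Bool, (∀ x, σ (Sum.inl x) = a x) → B.eval σ = true →
    r ≤ zHom σ L.coeff) ∧
  (u = false → ∀ σ : X ⊕ (Y ⊕ Z) → Bool, (∀ x, σ (Sum.inl x) = a x) → A.eval σ = true →
    L.const - xHom a L.coeff - r ≤ yHom σ L.coeff)

/-- **Clamping preserves the invariants** (and raises the flag soundly): if `(r, u)` satisfies
the invariants for `L` then so does `(clamp r (-Wz) Wz, u ∨ (Wz < r))` with `Wz = ∑ |γ|`.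
[cite: Pudlak1997, Thm. 3 (proof)] -/
theorem Inv.clamp {L : CPLine (X ⊕ (Y ⊕ Z))} {r : ℤ} {u : Bool} (h : Inv A B a L r u) :
    Inv A B a L (clamp r (-zNormHom L.coeff) (zNormHom L.coeff)) (u || decide (zNormHom L.coeff < r)) := by
  obtain ⟨h1, h2, h3⟩ := h
  refine ⟨fun hu => ?_, fun hu σ hσ hB => ?_, fun hu σ hσ hA => ?_⟩
  · rw [Bool.or_eq_true] at hu
    rcases hu with hu | hu
    · exact h1 hu
    · rw [decide_eq_true_eq] at hu
      rintro ⟨σ, hσ, hB⟩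
      cases hu' : u
      · have := h2 hu' σ hσ hB
        have hb := (abs_le.1 (abs_zHom_le σ L.coeff)).2
        linarith
      · exact h1 hu' ⟨σ, hσ, hB⟩
  · rw [Bool.or_eq_false_iff, decide_eq_false_iff_not, not_lt] at hu
    have hb := (abs_le.1 (abs_zHom_le σ L.coeff)).1
    by_cases hr : -zNormHom L.coeff ≤ r
    · rw [clamp_eq_self hr hu.2]; exact h2 hu.1 σ hσ hB
    · unfold CPSplit.clamp
      rw [min_eq_left hu.2, max_eq_left (by linarith)]
      exact hb
  · rw [Bool.or_eq_false_iff, decide_eq_false_iff_not, not_lt] at hu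
    have := h3 hu.1 σ hσ hA
    have hle := le_clamp_of_le (lo := -zNormHom L.coeff) hu.2
    linarith

/-- The raw value of a lower bound `x_v ≥ 0`. [cite: Pudlak1997, Thm. 3 (proof)] -/
theorem inv_lower (v : X ⊕ (Y ⊕ Z)) :
    Inv A B a (lower v) (Sum.elim (fun _ => 0) (Sum.elim (fun _ => 0) (fun _ => (lower v).const)) v) false := by
  refine ⟨fun h => Bool.noConfusion h, fun _ σ _ _ => ?_, fun _ σ _ _ => ?_⟩
  · rcases v with x | y | z <;> simp [lower, bit_nonneg]
  · rcases v with x | y | z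
    · simp only [lower, Sum.elim_inl, xHom_single_inl, one_mul, yHom_single_inl]
      linarith [bX_nonneg a x]
    · simp [lower, bit_nonneg]
    · simp [lower]

/-- The raw value of an upper bound `-x_v ≥ -1`. [cite: Pudlak1997, Thm. 3 (proof)] -/
theorem inv_upper (v : X ⊕ (Y ⊕ Z)) :
    Inv A B a (upper v) (Sum.elim (fun _ => 0) (Sum.elim (fun _ => 0) (fun _ => (upper v).const)) v) false := by
  refine ⟨fun h => Bool.noConfusion h, fun _ σ _ _ => ?_, fun _ σ _ _ => ?_⟩
  · rcases v with x | y | z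
    · simp [upper]
    · simp [upper]
    · simp only [upper, Sum.elim_inr, zHom_single_inr_inr, neg_mul, one_mul]
      linarith [bit_le_one σ (Sum.inr (Sum.inr z))]
  · rcases v with x | y | z
    · simp only [upper, Sum.elim_inl, xHom_single_inl, neg_mul, one_mul, yHom_single_inl]
      linarith [bX_le_one a x]
    · simp only [upper, Sum.elim_inr, Sum.elim_inl, xHom_single_inr_inl, yHom_single_inr_inl, neg_mul, one_mul]
      linarith [bit_le_one σ (Sum.inr (Sum.inl y))]
    · simp [upper]

/-- The raw value of a sum, from unflagged premises. [cite: Pudlak1997, Thm. 3 (proof)] -/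
theorem inv_add {L M : CPLine (X ⊕ (Y ⊕ Z))} {r r' : ℤ} {u u' : Bool} (h : Inv A B a L r u)
    (h' : Inv A B a M r' u') : Inv A B a (L + M) (r + r') (u || u') := by
  obtain ⟨h1, h2, h3⟩ := h
  obtain ⟨h1', h2', h3'⟩ := h'
  refine ⟨fun hu => ?_, fun hu σ hσ hB => ?_, fun hu σ hσ hA => ?_⟩
  · rw [Bool.or_eq_true] at hu
    rcases hu with hu | hu
    · exact h1 hu
    · exact h1' hu
  · rw [Bool.or_eq_false_iff] at hu
    rw [coeff_add, map_add]
    exact add_le_add (h2 hu.1 σ hσ hB) (h2' hu.2 σ hσ hB)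
  · rw [Bool.or_eq_false_iff] at hu
    rw [coeff_add, const_add, map_add, map_add]
    linarith [h3 hu.1 σ hσ hA, h3' hu.2 σ hσ hA]

/-- The raw value of a multiple. [cite: Pudlak1997, Thm. 3 (proof)] -/
theorem inv_smul {L : CPLine (X ⊕ (Y ⊕ Z))} {r : ℤ} {u : Bool} (h : Inv A B a L r u) (c : ℕ) :
    Inv A B a (smul c L) ((c : ℤ) * r) u := by
  obtain ⟨h1, h2, h3⟩ := h
  refine ⟨h1, fun hu σ hσ hB => ?_, fun hu σ hσ hA => ?_⟩
  · simp only [smul, map_zsmul, smul_eq_mul]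
    exact mul_le_mul_of_nonneg_left (h2 hu σ hσ hB) (by positivity)
  · simp only [smul, map_zsmul, smul_eq_mul]
    have := mul_le_mul_of_nonneg_left (h3 hu σ hσ hA) (show (0 : ℤ) ≤ c by positivity)
    linarith [mul_sub (c : ℤ) (L.const - xHom a L.coeff) r, mul_sub (c : ℤ) L.const (xHom a L.coeff)]

/-- The raw value of a Gomory–Chvátal cut (rounding up on both sides is sound because
`⌈·/c⌉` is subadditive). [cite: Pudlak1997, Thm. 3 (proof)] -/
theorem inv_divBy {L : CPLine (X ⊕ (Y ⊕ Z))} {r : ℤ} {u : Bool} (h : Inv A B a L r u) {c : ℕ}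
    (hc : 0 < c) (hdvd : ∀ v, (c : ℤ) ∣ L.coeff v) : Inv A B a (divBy c L) (ceilDiv r c) u := by
  obtain ⟨h1, h2, h3⟩ := h
  have hsm := smul_coeff_divBy hdvd
  refine ⟨h1, fun hu σ hσ hB => ?_, fun hu σ hσ hA => ?_⟩
  · refine ceilDiv_le_of_le_mul hc ?_
    have := h2 hu σ hσ hB
    have e : zHom σ L.coeff = (c : ℤ) * zHom σ (divBy c L).coeff := by
      conv_lhs => rw [← hsm]
      rw [map_zsmul, smul_eq_mul]
    linarith
  · rw [const_divBy]
    have := h3 hu σ hσ hA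
    have ex : xHom a L.coeff = (c : ℤ) * xHom a (divBy c L).coeff := by
      conv_lhs => rw [← hsm]
      rw [map_zsmul, smul_eq_mul]
    have ey : yHom σ L.coeff = (c : ℤ) * yHom σ (divBy c L).coeff := by
      conv_lhs => rw [← hsm]
      rw [map_zsmul, smul_eq_mul]
    rw [ex, ey] at this
    have h4 : ceilDiv (L.const - r) c ≤ xHom a (divBy c L).coeff + yHom σ (divBy c L).coeff :=
      ceilDiv_le_of_le_mul hc (by linarith [mul_add (c : ℤ) (xHom a (divBy c L).coeff) (yHom σ (divBy c L).coeff)])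
    have h5 := ceilDiv_add_le (d := L.const - r) (d' := r) hc
    rw [sub_add_cancel] at h5
    linarith

variable [DecidableEq X] [DecidableEq Y] [DecidableEq Z]

/-- The raw value of a clause of `A`. [cite: Pudlak1997, Thm. 3 (proof)] -/
theorem inv_initial_A (hA : ∀ C ∈ A, ∀ l ∈ C, okA l = true) {C : Clause (X ⊕ (Y ⊕ Z))} (hC : C ∈ A) :
    Inv A B a (ofClause C) 0 false := by
  refine ⟨fun h => Bool.noConfusion h, fun _ σ _ _ => ?_, fun _ σ hσ hAσ => ?_⟩
  · rw [zHom_ofClause_eq_zero (hA C hC)]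
  · have hh : (ofClause C).Holds σ := (holds_ofClause_iff C σ).2 ((CNF.eval_eq_true_iff A σ).1 hAσ C hC)
    unfold Holds lhs at hh
    rw [evalHom_eq_xHom_add a σ hσ, zHom_ofClause_eq_zero (hA C hC)] at hh
    linarith

/-- The raw value of a clause of `B`. [cite: Pudlak1997, Thm. 3 (proof)] -/
theorem inv_initial_B (hB : ∀ C ∈ B, ∀ l ∈ C, okB l = true) {C : Clause (X ⊕ (Y ⊕ Z))} (hC : C ∈ B) :
    Inv A B a (ofClause C) ((ofClause C).const - xHom a (ofClause C).coeff) false := by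
  refine ⟨fun h => Bool.noConfusion h, fun _ σ hσ hBσ => ?_, fun _ σ _ _ => ?_⟩
  · have hh : (ofClause C).Holds σ := (holds_ofClause_iff C σ).2 ((CNF.eval_eq_true_iff B σ).1 hBσ C hC)
    unfold Holds lhs at hh
    rw [evalHom_eq_xHom_add a σ hσ, yHom_ofClause_eq_zero (hB C hC)] at hh
    linarith
  · rw [yHom_ofClause_eq_zero (hB C hC)]
    linarith

/-- **The invariants hold along a derivation** from `A ++ B` (`A`-clauses over `x, y`;
`B`-clauses over `¬x, z`). [cite: Pudlak1997, Thm. 3 (proof)] -/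
theorem dz_invariant (hA : ∀ C ∈ A, ∀ l ∈ C, okA l = true) (hB : ∀ C ∈ B, ∀ l ∈ C, okB l = true)
    (hπ : IsCPDerivation (A ++ B) π) (k : ℕ) (hk : k < π.length) :
    Inv A B a (π[k]'hk).line (dz A π a k) (uz A π a k) := by
  induction k using Nat.strong_induction_on with
  | _ k ih =>
    have hval := hπ k hk
    have htk : (π.take k).length = k := by simp; omega
    unfold IsValidCPStep at hval
    -- the raw pair satisfies the invariants
    have hraw : Inv A B a (π[k]'hk).line (rawVal A π a k (prevOf A π a k)).1
        (rawVal A π a k (prevOf A π a k)).2 := by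
      unfold rawVal
      rw [List.getElem?_eq_getElem hk]
      dsimp only
      rcases hr : (π[k]'hk).rule with _ | v | v | ⟨i, j⟩ | ⟨c, i⟩ | ⟨c, i⟩ <;> rw [hr] at hval <;> dsimp only
      · -- initial clause
        obtain ⟨C, hC, hL⟩ := hval
        split_ifs with h
        · obtain ⟨C', hC', hL'⟩ := h
          rw [hL']
          exact inv_initial_A a hA hC'
        · have hCB : C ∈ B := by
            rcases List.mem_append.1 hC with hC | hC
            · exact absurd ⟨C, hC, hL⟩ h
            · exact hC
          rw [hL]
          exact inv_initial_B a hB hCB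
      · rw [hval]; exact inv_lower a v
      · rw [hval]; exact inv_upper a v
      · obtain ⟨hi, hj, hL⟩ := hval
        rw [htk] at hi hj
        rw [List.getElem_take, List.getElem_take] at hL
        rw [hL]
        have ei : prevOf A π a k i = dzuz A π a i := if_pos hi
        have ej : prevOf A π a k j = dzuz A π a j := if_pos hj
        rw [ei, ej]
        exact inv_add a (ih i hi (hi.trans hk)) (ih j hj (hj.trans hk))
      · obtain ⟨hi, hL⟩ := hval
        rw [htk] at hi
        rw [List.getElem_take] at hL
        rw [hL]
        have ei : prevOf A π a k i = dzuz A π a i := if_pos hi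
        rw [ei]
        exact inv_smul a (ih i hi (hi.trans hk)) c
      · obtain ⟨hi, hc, hdvd, hL⟩ := hval
        rw [htk] at hi
        rw [List.getElem_take] at hdvd hL
        rw [hL]
        have ei : prevOf A π a k i = dzuz A π a i := if_pos hi
        rw [ei]
        exact inv_divBy a (ih i hi (hi.trans hk)) hc hdvd
    -- clamping
    have hW : Wz π k = zNormHom (π[k]'hk).line.coeff := by
      unfold Wz; rw [List.getElem?_eq_getElem hk]
    unfold dz uz
    rw [dzuz_eq, lineVal, hW]
    exact hraw.clamp

/-- The INTERPOLANT BIT: the flag of the line, or its value being `≥ 1`. [cite: Pudlak1997, Thm. 3] -/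
noncomputable def interpAt (A : CNF (X ⊕ (Y ⊕ Z))) (π : List (CPStep (X ⊕ (Y ⊕ Z)))) (a : X → Bool) (k : ℕ) : Bool :=
  uz A π a k || decide (1 ≤ dz A π a k)

/-- **The interpolant decides the sides at a contradiction** `0 ≥ d`, `d > 0`: `true` refutes
`B(a,·)`, `false` refutes `A(a,·)`. [cite: Pudlak1997, Thm. 3] -/
theorem interp_correct (hA : ∀ C ∈ A, ∀ l ∈ C, okA l = true) (hB : ∀ C ∈ B, ∀ l ∈ C, okB l = true)
    (hπ : IsCPDerivation (A ++ B) π) {e : ℕ} (he : e < π.length) (hcon : (π[e]'he).line.IsContradiction) :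
    (interpAt A π a e = true → ¬ SatOver B a) ∧ (interpAt A π a e = false → ¬ SatOver A a) := by
  obtain ⟨h1, h2, h3⟩ := dz_invariant a hA hB hπ e he
  obtain ⟨hcoeff, hconst⟩ := hcon
  constructor
  · intro h
    rw [interpAt, Bool.or_eq_true] at h
    rcases h with h | h
    · exact h1 h
    · rw [decide_eq_true_eq] at h
      rintro ⟨σ, hσ, hBσ⟩
      cases hu : uz A π a e
      · have := h2 hu σ hσ hBσ
        rw [hcoeff, map_zero] at this
        linarith
      · exact h1 hu ⟨σ, hσ, hBσ⟩
  · intro h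
    rw [interpAt, Bool.or_eq_false_iff, decide_eq_false_iff_not, not_le] at h
    rintro ⟨σ, hσ, hAσ⟩
    have := h3 h.1 σ hσ hAσ
    rw [hcoeff, map_zero, map_zero] at this
    linarith

end Invariant

end CPSplit

end Literature.Computability.MetaComplexity
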